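import Summits.BirchSwinnertonDyer.Rank1Residual.AdditivePotMult.PotMultTateKummerPackage
import HarnessLib

/-!
# The Tate line at ALL levels: inertia acts on the whole line `C ≅ μ_{p^∞}` of a multiplicative
# `V/ℚ` through the `p`-adic cyclotomic character, and the Tate line package WITH that clause (cell
# `b2b-bsdres`, team n1011, seat p07 (gen 5); row T-RD-M, input of the UNIQUENESS of the ramified
# ordinary line; sequel of `PotMultTateKummerPackage`)

HONEST FRAMING (cell `b2b-bsdres`, run/shared/lean/b2b/bsd-rank1-residual/, verbatim in every
file): the goal of the cell is to DELETE the COMBINATION-SHAPED residual classes of the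
Birch–Swinnerton-Dyer formula for ALL analytic-rank `≤ 1` elliptic curves over `ℚ` — "full BSD
formula for every rank `≤ 1` curve in class `C`" assembled STRICTLY from published theorems — so
that the rank-`≤ 1` remainder becomes exactly the CONSTRUCTION-SHAPED classes, which are TYPED
(missing-input `Prop`s), NOT attempted. This is not "finishing BSD". Team n1011 (N10/N11, (M) rows):
research route; labels and marks UNCHANGED; nothing booked. Theorems only; NO definition; NO
Literature fact; the ONLY named facts are the published Tate uniformisation A40/A41 (`hT40`/`hT41`).
Debt 0.

## What

X2's `GreenbergVatsalTateDatumTorsion.smul_eq_nsmul_of_cyclotomicCharacter_eq` records the inertia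
action on the `p`-TORSION of the Tate line: `χ_p(σ) = k < p ⟹ res σ • c = k • c` for `p • c = 0`.
The uniqueness of the ramified ordinary line (the `∀ L` form of R-D) needs the action on the WHOLE
line: for `σ ∈ I_{ℚ_v}` with `χ(σ) = N ∈ ℕ` EXACTLY in `ℤ_p` (e.g. `N = p + 1`, an element of infinite
order of `ℤ_p^×`; such `σ` exist by X2's `exists_mem_absInertia_cyclotomicCharacter_eq_natCast`) and
EVERY `c ∈ C`: `res σ • c = N • c` (`smul_eq_nsmul_of_cyclotomicCharacter_eq_all`, via
`exists_pow_pow_eq_one_of_mem`: `ι c = Φ(ζ)` with `ζ ∈ μ_{p^j}` when `p^j • c = 0`, and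
`σζ = ζ^{N mod p^j} = ζ^N`). `exists_tateDatum_package_all` = `exists_tateDatum_package_kummer` + this
seventh clause, for the SAME datum.

References: R. Greenberg, V. Vatsal, Invent. Math. 142 (2000) §2 pp. 14–15; J. H. Silverman,
*ATAEC* V.3.1 (c),(d), V.5.3, Cor. V.5.4; J.-P. Serre, *Abelian ℓ-adic representations* I §1.2.
-/

noncomputable section

open scoped Classical NumberField AddSubgroup

namespace Summit.BirchSwinnertonDyer.Rank1Residual.AdditivePotMult

open NumberField IsDedekindDomain Field WeierstrassCurve
  Literature.NumberTheory.EllipticCurves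
  Literature.NumberTheory.EllipticCurves.GreenbergSelmer
  Literature.NumberTheory.GaloisRepresentations
  Summit.BirchSwinnertonDyer.Rank1Residual.X2
  Summit.BirchSwinnertonDyer.Rank1Residual.X2.GreenbergVatsalTateDatum
  Summit.BirchSwinnertonDyer.Rank1Residual.X2.GreenbergVatsalTateDatumCofree
  Summit.BirchSwinnertonDyer.Rank1Residual.X2.GreenbergVatsalTateDatumTorsion
  Summit.BirchSwinnertonDyer.Rank1Residual.X2.GreenbergVatsalTateKummer

namespace RamifiedOrdinaryLinePotMult

section AllLevel

variable (W : WeierstrassCurve ℚ) [W.IsElliptic] (p : ℕ) [hp : Fact p.Prime]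
  {v : HeightOneSpectrum (𝓞 ℚ)}
  (Φ : Additive (AlgebraicClosure (v.adicCompletion ℚ))ˣ →+ localPoints W (v.adicCompletion ℚ))
  (hΦ : ∀ (σ : absoluteGaloisGroup (v.adicCompletion ℚ))
    (u : (AlgebraicClosure (v.adicCompletion ℚ))ˣ),
    σ • Φ (Additive.ofMul u) = Φ (Additive.ofMul (Units.map
      (Field.absoluteGaloisGroup.toAlgEquiv (v.adicCompletion ℚ) σ :
        AlgebraicClosure (v.adicCompletion ℚ) →* AlgebraicClosure (v.adicCompletion ℚ)) u)) ∨
    σ • Φ (Additive.ofMul u) = -Φ (Additive.ofMul (Units.map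
      (Field.absoluteGaloisGroup.toAlgEquiv (v.adicCompletion ℚ) σ :
        AlgebraicClosure (v.adicCompletion ℚ) →* AlgebraicClosure (v.adicCompletion ℚ)) u)))
  {q : v.adicCompletion ℚ} (hq0 : q ≠ 0) (hq1 : Valued.v q < 1)
  (hker : ∀ u : (AlgebraicClosure (v.adicCompletion ℚ))ˣ, Φ (Additive.ofMul u) = 0 →
    ∃ a : ℤ, (u : AlgebraicClosure (v.adicCompletion ℚ)) =
      algebraMap (v.adicCompletion ℚ) (AlgebraicClosure (v.adicCompletion ℚ)) q ^ a)
  (hΦI : ∀ σ ∈ absInertia (v.adicCompletion ℚ), ∀ u : (AlgebraicClosure (v.adicCompletion ℚ))ˣ,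
    σ • Φ (Additive.ofMul u) = Φ (Additive.ofMul (Units.map
      (Field.absoluteGaloisGroup.toAlgEquiv (v.adicCompletion ℚ) σ :
        AlgebraicClosure (v.adicCompletion ℚ) →* AlgebraicClosure (v.adicCompletion ℚ)) u)))

omit [W.IsElliptic] hp in
include hq0 hq1 hker in
/-- Every point of the Tate line is `Φ(ζ)` for a `p`-POWER root of unity `ζ` (all levels: if
`p^j • c = 0` then `ζ^{p^j} ∈ q^ℤ ∩ μ = {1}`). [cite: SilvermanATAEC1994, Ch. V Thm. 3.1 (c),(d)] -/
theorem exists_pow_pow_eq_one_of_mem (c : W.geomPrimaryTorsion p) (hc : c ∈ (tateDatum W p Φ hΦ).plus)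
    {j : ℕ} (hpc : p ^ j • c = 0) :
    ∃ ζ : (AlgebraicClosure (v.adicCompletion ℚ))ˣ, ζ ^ p ^ j = 1 ∧
      Φ (Additive.ofMul ζ) = pointsMap W (v.adicCompletion ℚ) (c : W.geomPoints) := by
  obtain ⟨ζ, hζfin, hζc⟩ := hc
  refine ⟨ζ, ?_, hζc⟩
  have h0 : Φ (Additive.ofMul (ζ ^ p ^ j)) = 0 := by
    rw [ofMul_pow, map_nsmul, hζc, ← map_nsmul, hpc, map_zero]
  obtain ⟨a, ha⟩ := hker _ h0
  obtain ⟨n, hn, hζn⟩ := isOfFinOrder_iff_pow_eq_one.1 hζfin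
  have h1 : algebraMap (v.adicCompletion ℚ) (AlgebraicClosure (v.adicCompletion ℚ)) q ^
      (a * n) = 1 := by
    rw [zpow_mul, ← ha, zpow_natCast, ← Units.val_pow_eq_pow_val, ← pow_mul, mul_comm, pow_mul,
      hζn, one_pow, Units.val_one]
  have h2 : a * n = 0 := WeierstrassCurve.zpow_algebraMap_eq_one_imp v hq0 hq1 h1
  have ha0 : a = 0 := by
    rcases mul_eq_zero.mp h2 with h | h
    · exact h
    · exact absurd h (by exact_mod_cast hn.ne')
  rw [ha0, zpow_zero] at ha
  exact Units.ext ha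

omit [W.IsElliptic] in
include hq0 hq1 hker hΦI in
/-- **Inertia acts on the WHOLE Tate line through the `p`-adic cyclotomic character**: if
`σ ∈ I_{ℚ_v}` has `χ(σ) = N ∈ ℕ` (as an element of `ℤ_p`), then `res σ • c = N • c` for EVERY point
`c` of the Tate datum (`ι c = Φ(ζ)`, `ζ ∈ μ_{p^∞}`, `σζ = ζ^N`). The all-level form of X2's
`smul_eq_nsmul_of_cyclotomicCharacter_eq`. [cite: GreenbergVatsal2000, §2 pp. 14–15] -/
theorem smul_eq_nsmul_of_cyclotomicCharacter_eq_all {σ : absoluteGaloisGroup (v.adicCompletion ℚ)}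
    (hσ : σ ∈ absInertia (v.adicCompletion ℚ)) {N : ℕ}
    (hχ : ((GaloisRep.cyclotomicCharacter (v.adicCompletion ℚ) p σ : ℤ_[p]ˣ) : ℤ_[p]) = N)
    (c : W.geomPrimaryTorsion p) (hc : c ∈ (tateDatum W p Φ hΦ).plus) :
    absGaloisRestrict ℚ (v.adicCompletion ℚ) σ • c = N • c := by
  haveI : NeZero ((p : ℕ) : v.adicCompletion ℚ) := ⟨by
    rw [← map_natCast (algebraMap ℚ (v.adicCompletion ℚ))]
    exact (map_ne_zero_iff _ (algebraMap ℚ (v.adicCompletion ℚ)).injective).mpr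
      (Nat.cast_ne_zero.mpr hp.out.ne_zero)⟩
  obtain ⟨j, hj⟩ := (AddCommGroup.mem_primaryComponent).1 c.2
  have hpc : p ^ j • c = 0 := Subtype.ext (by exact_mod_cast hj)
  obtain ⟨ζ, hζp, hζc⟩ := exists_pow_pow_eq_one_of_mem W p Φ hΦ hq0 hq1 hker c hc hpc
  have hζp' : (ζ : AlgebraicClosure (v.adicCompletion ℚ)) ^ p ^ j = 1 := by
    rw [← Units.val_pow_eq_pow_val, hζp, Units.val_one]
  have hσζ : σ • (ζ : AlgebraicClosure (v.adicCompletion ℚ)) = (ζ : _) ^ N := by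
    rw [GaloisRep.cyclotomicCharacter_spec (v.adicCompletion ℚ) p σ _ hζp', hχ, map_natCast,
      ZMod.val_natCast]
    conv_rhs => rw [← Nat.mod_add_div N (p ^ j), pow_add, pow_mul, hζp', one_pow, mul_one]
  have hunit : Units.map (Field.absoluteGaloisGroup.toAlgEquiv (v.adicCompletion ℚ) σ :
      AlgebraicClosure (v.adicCompletion ℚ) →* AlgebraicClosure (v.adicCompletion ℚ)) ζ = ζ ^ N := by
    ext
    rw [Units.coe_map, MonoidHom.coe_coe, ← Field.absoluteGaloisGroup.smul_def, hσζ,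
      Units.val_pow_eq_pow_val]
  apply Subtype.ext
  apply pointsMapOfEmb_injective W (closureEmb (K := ℚ) (v.adicCompletion ℚ))
  change pointsMap W (v.adicCompletion ℚ)
      (absGaloisRestrict ℚ (v.adicCompletion ℚ) σ • (c : W.geomPoints)) =
    pointsMap W (v.adicCompletion ℚ) (((N • c : W.geomPrimaryTorsion p)) : W.geomPoints)
  rw [AddSubmonoidClass.coe_nsmul, map_nsmul, ← hζc, ← map_nsmul, ← ofMul_pow, ← hunit,
    ← hΦI σ hσ ζ, hζc]
  exact pointsMap_smul W (v.adicCompletion ℚ) σ (c : W.geomPoints)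

end AllLevel

/-! ### The package with the all-level clause -/

section Package

variable (V : WeierstrassCurve ℚ) [V.IsGloballyMinimal] [V.IsElliptic] (p : ℕ) [hp : Fact p.Prime]
  {v : HeightOneSpectrum (𝓞 ℚ)}

/-- **The Tate line package with BOTH local Kummer inclusions AND the all-level cyclotomic action**
(the SAME datum): clauses (i)–(vi) of `exists_tateDatum_package_kummer` and (vii) for every
`σ ∈ I_{ℚ_v}` and `N ∈ ℕ` with `χ(σ) = N` in `ℤ_p`, `res σ • c = N • c` for EVERY `c ∈ C`. Granted
A40/A41; `V` globally minimal, multiplicative at the odd prime `p`.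
[cite: GreenbergLNM1716, §2 pp. 74–76] [cite: GreenbergVatsal2000, §2 pp. 14–15]
[cite: SilvermanATAEC1994, Ch. V Thm. 3.1 (c),(d), Lemma 5.2 (c), Thm. 5.3, Cor. 5.4] -/
theorem exists_tateDatum_package_all (hT40 : Silverman1994_thmV53_tateUniformisation.{0})
    (hT41 : Silverman1994_thmV53_corV54_tateUniformisation.{0}) (hp2 : p ≠ 2)
    (hmult : V.HasMultiplicativeReductionAtPrime p) (hpv : ((p : ℕ) : 𝓞 ℚ) ∈ v.asIdeal) :
    ∃ N : LocalDatum ℚ (V.geomPrimaryTorsion p) v,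
      (∀ x ∈ inertia v, ∀ m : V.geomPrimaryTorsion p, x • m - m ∈ N.plus) ∧
      (∀ c ∈ N.plus, ∃ c' ∈ N.plus, p • c' = c) ∧
      Nat.card ↥(N.plus ⊓ AddSubgroup.torsionBy (↥(V.geomPrimaryTorsion p)) (p : ℤ)) = p ∧
      (∀ σ ∈ absInertia (v.adicCompletion ℚ), ∀ k : ℕ, k < p →
        ((GaloisRep.cyclotomicCharacter (v.adicCompletion ℚ) p σ : ℤ_[p]ˣ) : ℤ_[p]) = k →
        ∀ c ∈ N.plus, p • c = 0 → absGaloisRestrict ℚ (v.adicCompletion ℚ) σ • c = k • c) ∧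
      (∀ H : Subgroup (absoluteGaloisGroup ℚ),
        N.strictKer H ≤ V.localKerOver p H (v.adicCompletion ℚ)) ∧
      (∀ H : Subgroup (absoluteGaloisGroup ℚ),
        V.localKerOver p H (v.adicCompletion ℚ) ≤ N.greenbergKer H) ∧
      (∀ σ ∈ absInertia (v.adicCompletion ℚ), ∀ k : ℕ,
        ((GaloisRep.cyclotomicCharacter (v.adicCompletion ℚ) p σ : ℤ_[p]ˣ) : ℤ_[p]) = k →
        ∀ c ∈ N.plus, absGaloisRestrict ℚ (v.adicCompletion ℚ) σ • c = k • c) := by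
  by_cases hs : V.HasSplitMultiplicativeReductionAtPrime p
  · obtain ⟨q, Φ, hq0, hq1, hsurj, hker, hΦσ, -⟩ :=
      hT40 V v (GreenbergVatsalStrictSelmerMultiplicative.hasSplitMultiplicativeReductionAt_of_mem V p hs hpv)
    have hker' : ∀ u : (AlgebraicClosure (v.adicCompletion ℚ))ˣ, Φ (Additive.ofMul u) = 0 →
        ∃ a : ℤ, (u : AlgebraicClosure (v.adicCompletion ℚ)) =
          algebraMap (v.adicCompletion ℚ) (AlgebraicClosure (v.adicCompletion ℚ)) q ^ a :=
      fun u h ↦ (hker u).1 h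
    have hΦI : ∀ σ ∈ absInertia (v.adicCompletion ℚ), ∀ u : (AlgebraicClosure (v.adicCompletion ℚ))ˣ,
        σ • Φ (Additive.ofMul u) = Φ (Additive.ofMul (Units.map
          (Field.absoluteGaloisGroup.toAlgEquiv (v.adicCompletion ℚ) σ :
            AlgebraicClosure (v.adicCompletion ℚ) →* AlgebraicClosure (v.adicCompletion ℚ)) u)) :=
      fun σ _ u ↦ hΦσ σ u
    have hΦσ0 : ∀ (σ : absoluteGaloisGroup (v.adicCompletion ℚ))
        (u : (AlgebraicClosure (v.adicCompletion ℚ))ˣ),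
        σ • Φ (Additive.ofMul u) =
          (if Field.absoluteGaloisGroup.toAlgEquiv (v.adicCompletion ℚ) σ (0 : AlgebraicClosure
              (v.adicCompletion ℚ)) = 0 then (1 : ℤ) else -1) •
          Φ (Additive.ofMul (Units.map
            (Field.absoluteGaloisGroup.toAlgEquiv (v.adicCompletion ℚ) σ :
              AlgebraicClosure (v.adicCompletion ℚ) →* AlgebraicClosure (v.adicCompletion ℚ)) u)) := by
      intro σ u
      rw [map_zero, if_pos rfl, one_zsmul]
      exact hΦσ σ u
    have hts0 : ∀ σ : absoluteGaloisGroup (v.adicCompletion ℚ),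
        σ • (0 : AlgebraicClosure (v.adicCompletion ℚ)) = 0 ∨
          σ • (0 : AlgebraicClosure (v.adicCompletion ℚ)) = -0 :=
      fun σ ↦ Or.inl (smul_zero σ)
    refine ⟨tateDatum V p Φ (fun σ u ↦ Or.inl (hΦσ σ u)), tateDatum_htriv V p Φ _ hsurj hker' hΦI,
      tateDatum_plus_divisible V p Φ _, natCard_tateDatum_plus_inf_torsionBy V p Φ _ hq0 hq1 hker',
      fun σ hσ k hk hχ c hc hpc ↦ ?_, fun H ↦ ?_, fun H ↦ ?_, fun σ hσ k hχ c hc ↦ ?_⟩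
    · exact smul_eq_nsmul_of_cyclotomicCharacter_eq V p Φ _ hq0 hq1 hker' hΦI hσ hk hχ c hc hpc
    · exact strictKer_le_localKerOver_tate V p Φ 0 hq0 hq1 hker' hΦσ0 _ (fun m ↦ Iff.rfl) H hp2 hts0
    · exact GreenbergVatsalSelmerLink.localKerOver_le_greenbergKer V p H _
        (tateDatum_kummer V p Φ _ hsurj hker' hΦI hq0 hq1)
    · exact smul_eq_nsmul_of_cyclotomicCharacter_eq_all V p Φ _ hq0 hq1 hker' hΦI hσ hχ c hc
  · obtain ⟨q, t, Ψ, hq0, hq1, -, ht2, hsurj, hker, hΨσ, -⟩ :=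
      hT41 V v (GreenbergVatsalStrictSelmerMultiplicative.hasMultiplicativeReductionAt_of_mem V p hmult hpv)
    have hker' : ∀ u : (AlgebraicClosure (v.adicCompletion ℚ))ˣ, Ψ (Additive.ofMul u) = 0 →
        ∃ a : ℤ, (u : AlgebraicClosure (v.adicCompletion ℚ)) =
          algebraMap (v.adicCompletion ℚ) (AlgebraicClosure (v.adicCompletion ℚ)) q ^ a :=
      fun u h ↦ (hker u).1 h
    have hΨI : ∀ σ ∈ absInertia (v.adicCompletion ℚ), ∀ u : (AlgebraicClosure (v.adicCompletion ℚ))ˣ,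
        σ • Ψ (Additive.ofMul u) = Ψ (Additive.ofMul (Units.map
          (Field.absoluteGaloisGroup.toAlgEquiv (v.adicCompletion ℚ) σ :
            AlgebraicClosure (v.adicCompletion ℚ) →* AlgebraicClosure (v.adicCompletion ℚ)) u)) := by
      intro σ hσ u
      rw [hΨσ σ u, if_pos (GreenbergVatsalTateDatumRat.inertia_fix_sqrt_gamma V hp2 hmult hpv t ht2 σ hσ),
        one_zsmul]
    refine ⟨tateDatum V p Ψ (GreenbergVatsalTateDatumSign.sign_disj V Ψ t hΨσ),
      tateDatum_htriv V p Ψ _ hsurj hker' hΨI, tateDatum_plus_divisible V p Ψ _,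
      natCard_tateDatum_plus_inf_torsionBy V p Ψ _ hq0 hq1 hker', fun σ hσ k hk hχ c hc hpc ↦ ?_,
      fun H ↦ ?_, fun H ↦ ?_, fun σ hσ k hχ c hc ↦ ?_⟩
    · exact smul_eq_nsmul_of_cyclotomicCharacter_eq V p Ψ _ hq0 hq1 hker' hΨI hσ hk hχ c hc hpc
    · exact strictKer_le_localKerOver_tate V p Ψ t hq0 hq1 hker' hΨσ _ (fun m ↦ Iff.rfl) H hp2
        (smul_sqrt_eq_or V t ht2)
    · exact GreenbergVatsalSelmerLink.localKerOver_le_greenbergKer V p H _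
        (tateDatum_kummer V p Ψ _ hsurj hker' hΨI hq0 hq1)
    · exact smul_eq_nsmul_of_cyclotomicCharacter_eq_all V p Ψ _ hq0 hq1 hker' hΨI hσ hχ c hc

end Package

end RamifiedOrdinaryLinePotMult

end Summit.BirchSwinnertonDyer.Rank1Residual.AdditivePotMult

end
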